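import Summits.QuantumFields.BalabanUV.Beta.FP.PeriodisedSymBorderIndexWard
import Summits.QuantumFields.BalabanUV.Beta.CombWilsonT2Periodised
import Summits.QuantumFields.BalabanUV.Beta.CombBorderT2SiteLetter

/-!
# `BalabanUV.Beta.FP.PeriodisedSymBorderT2IndexWard` — road «FP» for binder row D1, ROUTE T, the dictionary's (J-a) item (α) AT ORDER 2 ON THE BORDER
# (an2's JA-TABLE v1.3 §2 row `c2 ∕ d2 ∕ q2`, v1.5 Δ4 «torus side … not typed»): **THE PERIODISED SECOND-ORDER BORDER TABLE `symVh₂SAn1` ALONG A TORUS PURE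
# GAUGE IN ITS FIRST BOND IS (MINUS) THE COMMUTATOR OF THE FIRST-ORDER BORDER MEMBER AT THE OTHER BOND WITH THE DIAGONAL GAUGE GENERATORS** — the border
# twin of an2 g42's `CombWilsonT2Periodised` §3 (`torus_H2_pureGauge_fst`), fed an2 g39's per-site letter (T2-B) `CombBorderT2SiteLetter.divV_borderT2_fst_site`
# through an2's period-lattice engine `sum_tgrad_mul_perZ_dper_of_indexLaw_periodCov` (my g18 engine under period covariance) on the `(inr, inl)` block

WHAT (`d = 3`, the (T2-B) letter's dimension; `F` any box with `Lc ∣ F i` — at the (III′) torus call `F = fine Lc M′`).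
* §1 Letters of an1's row border table `symVh₂SAn1 3 Lc κ u κ′ u′` (`SymSecondOrderTablesAn1`) on the `(inr μ, inl α)` block (multiplier leg at `x`,
  fluctuation leg at `z`): the entry formula through `symVh₂SAn1_antiTwin ∕ symVh₂SAn1_inl_inr`, the three FINITE supports (fluctuation leg `z`, first bond
  `u`, second bond `u′` — all in `nearBox Lc (blk Lc x)`, an1's `symVh2Tab_eq_zero₁ ∕ ₂ ∕ ₃`), and (T2-B) in `Σ`-form: **`sum_symVh₂SAn1_sub_inr_inl`**
  `Σ_κ (symVh₂SAn1 3 Lc κ (w − e_κ) κ′ u′ − symVh₂SAn1 3 Lc κ w κ′ u′) x z (inr μ) (inl α) = ([x + ρ_c = w] − [z = w]) · (−symVhSAt ρ_c 3 Lc rfl κ′ u′ x z (inr μ) (inl α))`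
  — an2's `divV_borderT2_fst_site` read at one entry with the numerals cancelled (`cVH ∕ (2·c₀·cB) = 1` at `d = 3`).
* §2 The SECOND-BOND-PERIODISED border bi-family (an2's convention, second bond first): `hV : V = fun κ′ u′ κ u x z a c => Σ'_n symVh₂SAn1 3 Lc κ u κ′ (u′ + F∘n) x z a c`:
  `summable_symVh₂SAn1_translate` (finitely many copies meet a column), `borderT2per_periodCov` (joint invariance under the period lattice, from an1's
  `symVh₂SAn1_translate`), window letters `borderT2per_inr_inl_eq_zero_of_not_mem_T ∕ _S`, and **`sum_borderT2per_sub_inr_inl`** (the first-slot law in the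
  engine's `hlaw` shape with contact kernel `q^{(κ′,u′)} := −dper F (symVhSAt ρ_c 3 Lc rfl κ′) u′` on `(inr, inl)`).
* §3 **`sum_tgrad_mul_perZ_dper_borderT2per`** (the engine applied) and the matrix forms — ANY box `M = Lc·M′`, ANY multiplier presentation
  `a ↦ (pμ a, inr (mμ a))` ((α-1)'s `_of_presentation` generality, so the SAME letters serve the door's fine level AND the coarse level one up, where the
  OWNER d1-p3 g22 binds `Q₂₂` over this bi-member on `M′`): **`torus_symQ12_pureGauge_fst_of_presentation`** ∕ **`_fst_fun_of_presentation`**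
  `Σ_b (Dλ)_b • Q₂^{b,β} = −(R_λ * Q₁^{β} − Q₁^{β} * E_λ)`, `Q₂^{b,β} := (perF M (dper M (W β.2 ↑β.1 b.2 ↑b.1))).submatrix …`,
  `Q₁^{β} := (perF M (dper M (symVhSAt ρ_c 3 Lc rfl β.2 ↑β.1))).submatrix …` (= (α-1)'s first-order member), `E_λ = diagonal (λ b.1)`,
  `R_λ = diagonal (Σ_s tdelta M (pμ a + ρ_c) s · λ s)` (the multiplier rotates at the ROOT of its block, as at order 1); and the (III′) corollary
  **`torus_symQ12_pureGauge_fst_fun`** (`F = fine Lc M″`, rows `(coarsePt M″ Lc a.1, inr a.2)`, `R_λ = diagonal (Σ_s tdelta F (Lc•a.1 + ρ_c) s · λ s)`).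
[folklore] re-indexing of finitely supported sums BY NAME; no `def`, no `def … : Prop`, nothing cited, 0 sorry.  Nothing of the dictionary ∕ Bałaban's
asserted: WHICH weight the door's `Q₁₂` carries (JA-TABLE v1.5 Δ1: `(cB∕cVH²) •` this family `= −c₀ ×` table at the locks) and how `Q₂₂ ∕ Db₂` are bound
(the road's (COV-m) order 2) are an2's ∕ the OWNER's; the `q2 ∕ c2 ∕ d2` rows are NOT discharged here (q2 waits for `Q₂₂`'s binding, c2∕d2 for the
border family's fluctuation-LEG law at order 2).

HONEST DEPENDENCY (page 1, mandatory): continuum YM on T⁴ ⇐ BetaPertH ∧ nine spine estimates (0/9 proved); BetaPertH ⇐ (D1) ∧ (D4) ∧ CAP+tail;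
G-an2-4 gates asym, D1 and NE2/3/4.  HONEST FRAMING (cell contract, verbatim): «discharging `BetaPertH` makes Bałaban's UV stability UNCONDITIONAL —
a real constructive-QFT result; it is NOT the continuum limit and NOT the Clay problem.»  ABSOLUTE RULE (cell charter, verbatim): «No internally-minted
statement may enter as a cited fact. Every hypothesis is either kernel-proved in this package or a verbatim quotation of a PUBLISHED theorem with page
reference. The manuscript(s) under audit are NOT citable for their own disputed steps — they are the thing under adjudication; programme-internal
(2001/route/tribunal) claims are never citable.»  0 estimates; 0∕4 row-D1 binders; NOT (T-ID), NOT (J-a) complete, NOT SDF, NOT D1, NOT BetaPertH, NOT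
continuum, NOT Clay.  D1 formalisation swarm LEAF PROVER 02 (b2b-balaban-beta-d1-formalise-leaf-02 gen 22), 2026-08-22.  No existing file touched.
-/

noncomputable section

open scoped BigOperators

namespace Summit.QuantumFields.BalabanUV.Beta.FP.PeriodisedSymBorderT2IndexWard

open Finset Matrix
open Literature.Probability.LatticeModels (Torus.proj)
open Literature.MathematicalPhysics.QuantumFieldTheory.Balaban1983to89
open Literature.MathematicalPhysics.QuantumFieldTheory.Balaban1983to89.Beta
open B4TorusKernel.MultiPeriod (translate translate_apply)
open B4Reflection242 (translate_translate)
open ExpKernelCalculus (MKer shiftK comp)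
open B5Prop11Plancherel (fine)
open B6Lemma24Torus (pbox mem_pbox)
open AffineAveraging (Site box toSite unitVec)
open AveragingContours (blk off)
open AveragingContoursRooted (ctr ctrOff ctrOff_mem_box)
open AveragingHessianKernels (Near)
open OneStepResolventKernel (Fib)
open AveragingWardStencils (b6UnitVec_eq)
open Summit.QuantumFields.BalabanUV.Beta.BorderedHessian (stepScale stepScale_ne_zero diagK comp_diagK_left comp_diagK_right)
open Summit.QuantumFields.BalabanUV.Beta.KernelWardLevels (stepScale_zero)
open Summit.QuantumFields.BalabanUV.Beta.AveragingWardRootedStencils (legInd legInd_inl legInd_inr)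
open Summit.QuantumFields.BalabanUV.Beta.DshAn1 (Dsh)
open Summit.QuantumFields.BalabanUV.Beta.SymAveragingHessianCounts (symVhSAt symVhSAt_translate)
open Summit.QuantumFields.BalabanUV.Beta.SymAveragingMixedJetTables (symVh2KerAt symVh2Tab_eq_zero₁ symVh2Tab_eq_zero₂ symVh2Tab_eq_zero₃)
open Summit.QuantumFields.BalabanUV.Beta.SymSecondOrderTablesAn1 (symVh₂SAn1 symVh₂SAn1_antiTwin symVh₂SAn1_swap symVh₂SAn1_translate)
open Summit.QuantumFields.BalabanUV.Beta.SymWardLettersUnpacking (symVh₂SAn1_inl_inr)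
open Summit.QuantumFields.BalabanUV.Beta.MixedWardPackingFF (divV_apply)
open Summit.QuantumFields.BalabanUV.Beta.CombBorderT2SiteLetter (divV_borderT2_fst_site)
open Summit.QuantumFields.BalabanUV.Beta.SymShiftedSpread (bhKStepSh)
open Summit.QuantumFields.BalabanUV.Beta.FP.KernelPeriodisationFib (Idx perF perF_apply perZ perZ_apply translate_eq_add)
open Summit.QuantumFields.BalabanUV.Beta.FP.KernelPeriodisationFibLoc (dper dper_apply)
open Summit.QuantumFields.BalabanUV.Beta.FP.TorusGaugeCovariance (tdelta tgrad nearBox mem_nearBox)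
open Summit.QuantumFields.BalabanUV.Beta.FP.TorusGaugeCovarianceCoarse (coarsePt coarsePt_coe)
open Summit.QuantumFields.BalabanUV.Beta.FP.TorusGaugeCovariancePairing (sum_tdelta_mul wrapPt_of_mem)
open Summit.QuantumFields.BalabanUV.Beta.FP.PeriodisedBorderIndexWard (translate_injective)
open Summit.QuantumFields.BalabanUV.Beta.FP.PeriodisedBorderTables (dper_apply_of_blockCov apply_translate_of_blockCov₂)
open Summit.QuantumFields.BalabanUV.Beta.FP.PeriodisedSymBorderIndexWard (symVhSAt_inr_inl_eq_zero_of_not_mem perZ_linSym04At_eq)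
open Summit.QuantumFields.BalabanUV.Beta.CombWilsonT2Periodised (dper_apply_of_periodCov sum_tgrad_mul_perZ_dper_of_indexLaw_periodCov)

variable {Lc : ℕ} [NeZero Lc]

/-! ## §1 The letters of an1's row border table `symVh₂SAn1 3 Lc` on the `(inr, inl)` block -/

section Letters

omit [NeZero Lc] in
/-- [folklore] **THE `(inr μ, inl α)` ENTRY OF THE ROW BORDER TABLE** (multiplier leg at `x`, fluctuation leg at `z`): minus the anti-twin `(inl α, inr μ)`
entry at `(z, x)` (`symVh₂SAn1_antiTwin`), i.e. `−[off Lc x = 0]·½(s^sym_μ(blk x)((α,z); (κ,u), (κ′,u′)) + s^sym_μ(blk x)((α,z); (κ′,u′), (κ,u)))`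
(`SymWardLettersUnpacking.symVh₂SAn1_inl_inr`). -/
theorem symVh₂SAn1_inr_inl (κ : Fin 4) (u : Site 4) (κ' : Fin 4) (u' x z : Site 4) (μ α : Fin 4) :
    symVh₂SAn1 3 Lc κ u κ' u' x z (Sum.inr μ) (Sum.inl α)
      = -(if off Lc x = 0 then (1 / 2 : ℝ) * (symVh2KerAt (ctr 4 Lc) Lc μ (blk Lc x) (α, z) (κ, u) (κ', u')
          + symVh2KerAt (ctr 4 Lc) Lc μ (blk Lc x) (α, z) (κ', u') (κ, u)) else 0) := by
  rw [symVh₂SAn1_antiTwin, symVh₂SAn1_inl_inr]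

/-- [folklore] the real second-order border kernel vanishes when its fluctuation leg is off the support box of the block (an1's `symVh2Tab_eq_zero₁`). -/
theorem symVh2KerAt_eq_zero_of_not_near {L : ℕ} {r : Fin 4 → ℕ} (hr : r ∈ box 4 L) (μ : Fin 4) (y : Site 4) {f : AveragingHessianKernels.Bond 4}
    (h : ¬ Near L y f.2) (g g' : AveragingHessianKernels.Bond 4) : symVh2KerAt (toSite r) L μ y f g g' = 0 := by
  unfold symVh2KerAt
  rw [symVh2Tab_eq_zero₁ hr μ y h]
  push_cast
  rfl

/-- [folklore] … or when its first background bond is off the box (`symVh2Tab_eq_zero₂`). -/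
theorem symVh2KerAt_eq_zero_of_not_near₂ {L : ℕ} {r : Fin 4 → ℕ} (hr : r ∈ box 4 L) (μ : Fin 4) (y : Site 4) (f : AveragingHessianKernels.Bond 4)
    {g : AveragingHessianKernels.Bond 4} (h : ¬ Near L y g.2) (g' : AveragingHessianKernels.Bond 4) : symVh2KerAt (toSite r) L μ y f g g' = 0 := by
  unfold symVh2KerAt
  rw [symVh2Tab_eq_zero₂ hr μ y f h]
  push_cast
  rfl

/-- [folklore] … or when its second background bond is off the box (`symVh2Tab_eq_zero₃`). -/
theorem symVh2KerAt_eq_zero_of_not_near₃ {L : ℕ} {r : Fin 4 → ℕ} (hr : r ∈ box 4 L) (μ : Fin 4) (y : Site 4) (f g : AveragingHessianKernels.Bond 4)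
    {g' : AveragingHessianKernels.Bond 4} (h : ¬ Near L y g'.2) : symVh2KerAt (toSite r) L μ y f g g' = 0 := by
  unfold symVh2KerAt
  rw [symVh2Tab_eq_zero₃ hr μ y f g h]
  push_cast
  rfl

/-- [folklore] fluctuation-slot support of the `(inr, inl)` entries of `symVh₂SAn1 3 Lc` (centred root; an1's `symVh2Tab_eq_zero₁` through the packing). -/
theorem symVh₂SAn1_inr_inl_eq_zero_of_not_mem (κ : Fin 4) (u : Site 4) (κ' : Fin 4) (u' x : Site 4) (μ α : Fin 4)
    {z : Site 4} (hz : z ∉ nearBox Lc (blk Lc x)) : symVh₂SAn1 3 Lc κ u κ' u' x z (Sum.inr μ) (Sum.inl α) = 0 := by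
  have hLc : 1 ≤ Lc := Nat.one_le_iff_ne_zero.mpr (NeZero.ne Lc)
  rw [mem_nearBox] at hz
  rw [symVh₂SAn1_inr_inl, show ctr 4 Lc = toSite (ctrOff 4 Lc) from rfl,
    symVh2KerAt_eq_zero_of_not_near (ctrOff_mem_box hLc) μ (blk Lc x) (f := (α, z)) hz,
    symVh2KerAt_eq_zero_of_not_near (ctrOff_mem_box hLc) μ (blk Lc x) (f := (α, z)) hz]
  simp

/-- [folklore] first-bond (family-index) support of the `(inr, inl)` entries of `symVh₂SAn1 3 Lc` (`symVh2Tab_eq_zero₂ ∕ ₃`). -/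
theorem symVh₂SAn1_inr_inl_eq_zero_of_not_mem_fst (κ : Fin 4) (κ' : Fin 4) (u' x z : Site 4) (μ α : Fin 4)
    {u : Site 4} (hu : u ∉ nearBox Lc (blk Lc x)) : symVh₂SAn1 3 Lc κ u κ' u' x z (Sum.inr μ) (Sum.inl α) = 0 := by
  have hLc : 1 ≤ Lc := Nat.one_le_iff_ne_zero.mpr (NeZero.ne Lc)
  rw [mem_nearBox] at hu
  rw [symVh₂SAn1_inr_inl, show ctr 4 Lc = toSite (ctrOff 4 Lc) from rfl,
    symVh2KerAt_eq_zero_of_not_near₂ (ctrOff_mem_box hLc) μ (blk Lc x) _ (g := (κ, u)) hu,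
    symVh2KerAt_eq_zero_of_not_near₃ (ctrOff_mem_box hLc) μ (blk Lc x) _ _ (g' := (κ, u)) hu]
  simp

/-- [folklore] second-bond support of the `(inr, inl)` entries of `symVh₂SAn1 3 Lc` (`symVh2Tab_eq_zero₃ ∕ ₂`). -/
theorem symVh₂SAn1_inr_inl_eq_zero_of_not_mem_snd (κ : Fin 4) (u : Site 4) (κ' : Fin 4) (x z : Site 4) (μ α : Fin 4)
    {u' : Site 4} (hu' : u' ∉ nearBox Lc (blk Lc x)) : symVh₂SAn1 3 Lc κ u κ' u' x z (Sum.inr μ) (Sum.inl α) = 0 := by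
  have hLc : 1 ≤ Lc := Nat.one_le_iff_ne_zero.mpr (NeZero.ne Lc)
  rw [mem_nearBox] at hu'
  rw [symVh₂SAn1_inr_inl, show ctr 4 Lc = toSite (ctrOff 4 Lc) from rfl,
    symVh2KerAt_eq_zero_of_not_near₃ (ctrOff_mem_box hLc) μ (blk Lc x) _ _ (g' := (κ', u')) hu',
    symVh2KerAt_eq_zero_of_not_near₂ (ctrOff_mem_box hLc) μ (blk Lc x) _ (g := (κ', u')) hu']
  simp

/-- [folklore] **an2's (T2-B) IN `Σ`-FORM ON THE `(inr, inl)` BLOCK, NUMERALS CANCELLED** (`CombBorderT2SiteLetter.divV_borderT2_fst_site` read at the entry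
`(x, z, inr μ, inl α)`; `cVH ∕ (2·c₀·cB) = 1` at `d = 3`): `Σ_κ (symVh₂SAn1 3 Lc κ (w − e_κ) κ′ u′ − symVh₂SAn1 3 Lc κ w κ′ u′) x z (inr μ) (inl α)
= ([x + ρ_c = w] − [z = w]) · (−symVhSAt ρ_c 3 Lc rfl κ′ u′ x z (inr μ) (inl α))` — the multiplier leg rotates at the ROOT `x + ρ_c`, the fluctuation leg at
its base, the contact kernel is MINUS the first-order border table at the OTHER bond. -/
theorem sum_symVh₂SAn1_sub_inr_inl (κ' : Fin 4) (u' w x z : Site 4) (μ α : Fin 4) :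
    ∑ κ : Fin 4, (symVh₂SAn1 3 Lc κ (w - unitVec κ) κ' u' x z (Sum.inr μ) (Sum.inl α) - symVh₂SAn1 3 Lc κ w κ' u' x z (Sum.inr μ) (Sum.inl α))
      = ((if x + ctr 4 Lc = w then (1 : ℝ) else 0) - (if z = w then 1 else 0))
        * -symVhSAt (ctr 4 Lc) 3 Lc rfl κ' u' x z (Sum.inr μ) (Sum.inl α) := by
  have hL : (Lc : ℝ) ≠ 0 := by exact_mod_cast NeZero.ne Lc
  have h := congrFun (congrFun (congrFun (congrFun (divV_borderT2_fst_site (Lc := Lc) κ' u' w) x) z) (Sum.inr μ)) (Sum.inl α)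
  rw [Pi.smul_apply, Pi.smul_apply, Pi.smul_apply, Pi.smul_apply, smul_eq_mul, divV_apply, Pi.sub_apply, Pi.sub_apply, Pi.sub_apply,
    Pi.sub_apply, comp_diagK_right, comp_diagK_left, Pi.smul_apply, Pi.smul_apply, Pi.smul_apply, Pi.smul_apply, smul_eq_mul,
    Pi.smul_apply, Pi.smul_apply, smul_eq_mul, Pi.smul_apply, Pi.smul_apply, smul_eq_mul, legInd_inl, legInd_inr, stepScale_zero, one_mul] at h
  simp only [Pi.smul_apply, smul_eq_mul, ← mul_sub, ← Finset.mul_sum, b6UnitVec_eq] at h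
  have hc : ((Lc : ℝ) ^ (3 + 1))⁻¹ * (-((Lc : ℝ) ^ 12 / 4)) ≠ 0 :=
    mul_ne_zero (inv_ne_zero (pow_ne_zero _ hL)) (neg_ne_zero.2 (div_ne_zero (pow_ne_zero _ hL) (by norm_num)))
  refine mul_left_cancel₀ hc ?_
  rw [mul_assoc, h]
  field_simp
  ring

end Letters

/-! ## §2 The second-bond-periodised border bi-family: copies, period covariance, windows, the first-slot law in `hlaw` shape -/

section Family

variable {M M' : Fin 4 → ℕ} [∀ μ, NeZero (M μ)] (κ' : Fin 4) (u' : Site 4)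
  {V : Fin 4 → Site 4 → MKer 4 (Fib 3)}

/-- [folklore] the copies of the second bond meeting the block of the multiplier leg `x` are finitely many: on the `(inr, inl)` block,
`n ↦ symVh₂SAn1 3 Lc κ u κ′ (u′ + M∘n) x z (inr μ) (inl α)` is summable (second-bond support `nearBox Lc (blk Lc x)`). -/
theorem summable_symVh₂SAn1_translate_inr_inl (κ : Fin 4) (u x z : Site 4) (μ α : Fin 4) :
    Summable fun n : Site 4 => symVh₂SAn1 3 Lc κ u κ' (translate M u' n) x z (Sum.inr μ) (Sum.inl α) :=
  summable_of_ne_finset_zero (s := (nearBox Lc (blk Lc x)).preimage (fun n => translate M u' n) (translate_injective (M := M) u').injOn)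
    fun _ hn => symVh₂SAn1_inr_inl_eq_zero_of_not_mem_snd κ u κ' x z μ α (fun h => hn (Finset.mem_preimage.2 h))

omit [∀ μ, NeZero (M μ)] in
/-- [folklore] **JOINT INVARIANCE UNDER THE PERIOD LATTICE** of the second-bond-periodised border bi-family
`V κ u := Σ'_n symVh₂SAn1 3 Lc κ u κ′ (u′ + M∘n)` (`M = Lc·M′`): `V κ (u + M∘m) (x + M∘m) (z + M∘m) = V κ u x z` — an1's block covariance
`symVh₂SAn1_translate` per copy (my `apply_translate_of_blockCov₂`), re-indexing `n ↦ n + m`; no convergence needed. -/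
theorem borderT2per_periodCov (hM : ∀ i, M i = Lc * M' i)
    (hV : V = fun κ u x z a c => ∑' n : Site 4, symVh₂SAn1 3 Lc κ u κ' (translate M u' n) x z a c)
    (κ : Fin 4) (u m x z : Site 4) (a c : Fib 3) :
    V κ (translate M u m) (translate M x m) (translate M z m) a c = V κ u x z a c := by
  have hLc : 1 ≤ Lc := Nat.one_le_iff_ne_zero.mpr (NeZero.ne Lc)
  subst hV
  show (∑' n : Site 4, symVh₂SAn1 3 Lc κ (translate M u m) κ' (translate M u' n) (translate M x m) (translate M z m) a c)
      = ∑' n : Site 4, symVh₂SAn1 3 Lc κ u κ' (translate M u' n) x z a c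
  rw [← (Equiv.addRight m).tsum_eq (fun n => symVh₂SAn1 3 Lc κ (translate M u m) κ' (translate M u' n) (translate M x m) (translate M z m) a c)]
  refine tsum_congr fun n => ?_
  rw [Equiv.coe_addRight, apply_translate_of_blockCov₂ hM (fun κ u κ' u' t => symVh₂SAn1_translate hLc κ u κ' u' t) κ (translate M u m) κ'
      (translate M u' (n + m)) m x z a c, translate_translate, translate_translate, add_neg_cancel, add_neg_cancel_right]
  congr 1
  funext i
  rw [translate_apply, Pi.zero_apply, mul_zero, add_zero]

omit [∀ μ, NeZero (M μ)] in
/-- [folklore] window letter `hT` (first bond = family index): on the `(inr, inl)` block `V κ u x z` vanishes unless `u ∈ nearBox Lc (blk Lc x)`. -/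
theorem borderT2per_inr_inl_eq_zero_of_not_mem_T
    (hV : V = fun κ u x z a c => ∑' n : Site 4, symVh₂SAn1 3 Lc κ u κ' (translate M u' n) x z a c)
    (κ : Fin 4) (x z : Site 4) (μ α : Fin 4) :
    ∀ u ∉ nearBox Lc (blk Lc x), V κ u x z (Sum.inr μ) (Sum.inl α) = 0 := fun u hu => by
  subst hV
  exact (tsum_congr fun n => symVh₂SAn1_inr_inl_eq_zero_of_not_mem_fst κ κ' _ x z μ α hu).trans tsum_zero

omit [∀ μ, NeZero (M μ)] in
/-- [folklore] window letter `hS` (fluctuation leg): on the `(inr, inl)` block `V κ u x z` vanishes unless `z ∈ nearBox Lc (blk Lc x)`. -/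
theorem borderT2per_inr_inl_eq_zero_of_not_mem_S
    (hV : V = fun κ u x z a c => ∑' n : Site 4, symVh₂SAn1 3 Lc κ u κ' (translate M u' n) x z a c)
    (κ : Fin 4) (u x : Site 4) (μ α : Fin 4) :
    ∀ z ∉ nearBox Lc (blk Lc x), V κ u x z (Sum.inr μ) (Sum.inl α) = 0 := fun z hz => by
  subst hV
  exact (tsum_congr fun n => symVh₂SAn1_inr_inl_eq_zero_of_not_mem κ u κ' _ x μ α hz).trans tsum_zero

omit [∀ μ, NeZero (M μ)] in
/-- [folklore] the contact kernel's window (`hqS`): the periodised first-order border member `dper M (symVhSAt ρ_c 3 Lc rfl κ′ u′)` vanishes on the `(inr, inl)`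
block unless `z ∈ nearBox Lc (blk Lc x)` ((α-1)'s support letter under the copy sum; `M = Lc·M′`). -/
theorem dper_symVhSAt_inr_inl_eq_zero_of_not_mem (hM : ∀ i, M i = Lc * M' i) (x : Site 4) (μ α : Fin 4) :
    ∀ z ∉ nearBox Lc (blk Lc x), dper M (symVhSAt (ctr 4 Lc) 3 Lc rfl κ' u') x z (Sum.inr μ) (Sum.inl α) = 0 := fun z hz => by
  have hLc : 1 ≤ Lc := Nat.one_le_iff_ne_zero.mpr (NeZero.ne Lc)
  rw [show ctr 4 Lc = toSite (ctrOff 4 Lc) from rfl,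
    dper_apply_of_blockCov hM (fun κ u t => symVhSAt_translate (toSite (ctrOff 4 Lc)) hLc κ u t) κ' u' x z (Sum.inr μ) (Sum.inl α)]
  exact (tsum_congr fun n => symVhSAt_inr_inl_eq_zero_of_not_mem (ctrOff_mem_box hLc) κ' _ x μ α hz).trans tsum_zero

/-- [folklore] **`sum_borderT2per_sub_inr_inl` — THE FIRST-SLOT INDEX LAW OF THE SECOND-BOND-PERIODISED BORDER BI-FAMILY** in the engine's `hlaw` shape on the
`(inr, inl)` block (`M = Lc·M′`): `Σ_κ (V κ (w − e_κ) − V κ w) x z (inr μ) (inl α) = ([x + ρ_c = w] − [z = w]) · (−dper M (symVhSAt ρ_c 3 Lc rfl κ′ u′)) x z (inr μ) (inl α)`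
— §1's (T2-B) Σ-form for each copy `u′ + M∘n` of the second bond, summed; `Σ'_n symVhSAt κ′ (u′ + M∘n) = dper M (symVhSAt κ′ u′)` (`dper_apply_of_blockCov`). -/
theorem sum_borderT2per_sub_inr_inl (hM : ∀ i, M i = Lc * M' i)
    (hV : V = fun κ u x z a c => ∑' n : Site 4, symVh₂SAn1 3 Lc κ u κ' (translate M u' n) x z a c)
    (w x z : Site 4) (μ α : Fin 4) :
    ∑ κ : Fin 4, (V κ (w - unitVec κ) x z (Sum.inr μ) (Sum.inl α) - V κ w x z (Sum.inr μ) (Sum.inl α))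
      = ((if x + ctr 4 Lc = w then (1 : ℝ) else 0) - (if z = w then 1 else 0))
          * (-dper M (symVhSAt (ctr 4 Lc) 3 Lc rfl κ' u')) x z (Sum.inr μ) (Sum.inl α) := by
  have hLc : 1 ≤ Lc := Nat.one_le_iff_ne_zero.mpr (NeZero.ne Lc)
  subst hV
  -- termwise difference of two convergent copy sums, then the finite `κ`-sum inside the `n`-sum
  have hsum : ∀ κ : Fin 4,
      (∑' n : Site 4, symVh₂SAn1 3 Lc κ (w - unitVec κ) κ' (translate M u' n) x z (Sum.inr μ) (Sum.inl α))
        - (∑' n : Site 4, symVh₂SAn1 3 Lc κ w κ' (translate M u' n) x z (Sum.inr μ) (Sum.inl α))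
      = ∑' n : Site 4, (symVh₂SAn1 3 Lc κ (w - unitVec κ) κ' (translate M u' n) x z (Sum.inr μ) (Sum.inl α)
          - symVh₂SAn1 3 Lc κ w κ' (translate M u' n) x z (Sum.inr μ) (Sum.inl α)) := fun κ =>
    ((summable_symVh₂SAn1_translate_inr_inl (M := M) κ' u' κ (w - unitVec κ) x z μ α).tsum_sub
      (summable_symVh₂SAn1_translate_inr_inl (M := M) κ' u' κ w x z μ α)).symm
  simp only [hsum]
  rw [← Summable.tsum_finsetSum (fun κ _ => (summable_symVh₂SAn1_translate_inr_inl (M := M) κ' u' κ (w - unitVec κ) x z μ α).sub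
    (summable_symVh₂SAn1_translate_inr_inl (M := M) κ' u' κ w x z μ α))]
  -- the (T2-B) letter, copy by copy
  rw [tsum_congr fun n => sum_symVh₂SAn1_sub_inr_inl (Lc := Lc) κ' (translate M u' n) w x z μ α, tsum_mul_left, Pi.neg_apply, Pi.neg_apply,
    Pi.neg_apply, Pi.neg_apply, show ctr 4 Lc = toSite (ctrOff 4 Lc) from rfl,
    dper_apply_of_blockCov hM (fun κ u t => symVhSAt_translate (toSite (ctrOff 4 Lc)) hLc κ u t) κ' u' x z (Sum.inr μ) (Sum.inl α), tsum_neg]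

end Family

/-! ## §3 The periodised border bi-member along a torus pure gauge in its FIRST bond; matrix forms at the (III′) torus call's types -/

section Torus

variable {M M' : Fin 4 → ℕ} [∀ μ, NeZero (M μ)] (κ' : Fin 4) (u' : Site 4)
  {V : Fin 4 → Site 4 → MKer 4 (Fib 3)}

/-- [folklore] **`sum_tgrad_mul_perZ_dper_borderT2per` — THE PERIODISED SECOND-ORDER BORDER MEMBER ALONG A TORUS PURE GAUGE IN ITS FIRST BOND** (`M = Lc·M′`;
an2's period-lattice engine `sum_tgrad_mul_perZ_dper_of_indexLaw_periodCov` fed §2's letters): for the torus gauge parameter `s`, the multiplier row `(x, μ)`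
and the fluctuation leg `(z, α)`,
`Σ_{u ∈ pbox M} Σ_κ tgrad M (u, inl κ) s · perZ M (dper M (V κ u)) x z (inr μ) (inl α) = −(tdelta M (x + ρ_c) s − tdelta M z s) · perZ M (dper M (symVhSAt ρ_c 3 Lc rfl κ′ u′)) x z (inr μ) (inl α)`. -/
theorem sum_tgrad_mul_perZ_dper_borderT2per (hM : ∀ i, M i = Lc * M' i)
    (hV : V = fun κ u x z a c => ∑' n : Site 4, symVh₂SAn1 3 Lc κ u κ' (translate M u' n) x z a c)
    (s : ↥(pbox M)) (x z : Site 4) (μ α : Fin 4) :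
    ∑ u : ↥(pbox M), ∑ κ : Fin 4, tgrad M (u, Sum.inl κ) s * perZ M (dper M (V κ (u : Site 4))) x z (Sum.inr μ) (Sum.inl α)
      = -((tdelta M (x + ctr 4 Lc) s - tdelta M z s)
          * perZ M (dper M (symVhSAt (ctr 4 Lc) 3 Lc rfl κ' u')) x z (Sum.inr μ) (Sum.inl α)) := by
  have hqS : ∀ x : Site 4, ∀ z ∉ nearBox Lc (blk Lc x), (-dper M (symVhSAt (ctr 4 Lc) 3 Lc rfl κ' u')) x z (Sum.inr μ) (Sum.inl α) = 0 :=
    fun x z hz => by rw [Pi.neg_apply, Pi.neg_apply, Pi.neg_apply, Pi.neg_apply, dper_symVhSAt_inr_inl_eq_zero_of_not_mem κ' u' hM x μ α z hz, neg_zero]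
  rw [sum_tgrad_mul_perZ_dper_of_indexLaw_periodCov V (-dper M (symVhSAt (ctr 4 Lc) 3 Lc rfl κ' u')) (fun x => x + ctr 4 Lc)
    (fun x => nearBox Lc (blk Lc x)) (fun x => nearBox Lc (blk Lc x)) (Sum.inr μ) (Sum.inl α)
    (borderT2per_periodCov κ' u' hM hV) (fun κ u x => borderT2per_inr_inl_eq_zero_of_not_mem_S κ' u' hV κ u x μ α)
    (fun κ x z => borderT2per_inr_inl_eq_zero_of_not_mem_T κ' u' hV κ x z μ α) hqS (fun w x z => sum_borderT2per_sub_inr_inl κ' u' hM hV w x z μ α) s x z]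
  rw [perZ_apply, perZ_apply]
  simp only [Pi.neg_apply, tsum_neg, mul_neg]

/-- [folklore] **`torus_symQ12_pureGauge_fst_of_presentation` — ANY BOX, ANY MULTIPLIER PRESENTATION** (`M = Lc·M″`; multiplier rows `a ↦ (pμ a, inr (mμ a))`,
`pμ a ∈ pbox M` — the `Q`-slot presentation of (α-1)'s `torus_sym_pureGauge_of_presentation`; at the (III′) torus call `M = fine Lc M′`, `pμ a = coarsePt M′ Lc a.1`,
ONE LEVEL UP `M = M′`, `pμ = pμ′`): for the second torus bond `β` and every torus gauge parameter `s`,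
`Σ_b tgrad M (b.1, inl b.2) s • Q₂^{b,β} = −(R_s * Q₁^{β} − Q₁^{β} * E_s)` with `Q₂^{b,β} := (perF M (dper M (W β.2 ↑β.1 b.2 ↑b.1))).submatrix …` (the
second-bond-periodised border bi-member, `hW`), `Q₁^{β} := (perF M (dper M (symVhSAt ρ_c 3 Lc rfl β.2 ↑β.1))).submatrix …` ((α-1)'s first-order member),
`E_s := diagonal (tdelta M b.1 s)`, `R_s := diagonal (tdelta M (pμ a + ρ_c) s)` (the multiplier rotates at the ROOT of its block, as at order 1). -/
theorem torus_symQ12_pureGauge_fst_of_presentation (hM : ∀ i, M i = Lc * M' i) {W : Fin 4 → Site 4 → Fin 4 → Site 4 → MKer 4 (Fib 3)}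
    (hW : W = fun κ' u' κ u x z a c => ∑' n : Site 4, symVh₂SAn1 3 Lc κ u κ' (translate M u' n) x z a c)
    {κI : Type*} [Fintype κI] [DecidableEq κI] (pμ : κI → Site 4) (hpμ : ∀ a, pμ a ∈ pbox M) (mμ : κI → Fin 4)
    (β : ↥(pbox M) × Fin 4) (s : ↥(pbox M)) :
    (∑ b : ↥(pbox M) × Fin 4, tgrad M (b.1, Sum.inl b.2) s •
        (perF M (dper M (W β.2 (β.1 : Site 4) b.2 (b.1 : Site 4)))).submatrix
          (fun a : κI => ((⟨pμ a, hpμ a⟩, Sum.inr (mμ a)) : Idx M (Fib 3)))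
          (fun b : ↥(pbox M) × Fin 4 => ((b.1, Sum.inl b.2) : Idx M (Fib 3))))
      = -(Matrix.diagonal (fun a : κI => tdelta M (pμ a + ctr 4 Lc) s)
            * (perF M (dper M (symVhSAt (ctr 4 Lc) 3 Lc rfl β.2 (β.1 : Site 4)))).submatrix
              (fun a : κI => ((⟨pμ a, hpμ a⟩, Sum.inr (mμ a)) : Idx M (Fib 3)))
              (fun b : ↥(pbox M) × Fin 4 => ((b.1, Sum.inl b.2) : Idx M (Fib 3)))
          - (perF M (dper M (symVhSAt (ctr 4 Lc) 3 Lc rfl β.2 (β.1 : Site 4)))).submatrix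
              (fun a : κI => ((⟨pμ a, hpμ a⟩, Sum.inr (mμ a)) : Idx M (Fib 3)))
              (fun b : ↥(pbox M) × Fin 4 => ((b.1, Sum.inl b.2) : Idx M (Fib 3)))
            * Matrix.diagonal (fun b : ↥(pbox M) × Fin 4 => tdelta M (b.1 : Site 4) s)) := by
  have hV : W β.2 (β.1 : Site 4) = fun κ u x z a c => ∑' n : Site 4, symVh₂SAn1 3 Lc κ u β.2 (translate M (β.1 : Site 4) n) x z a c := by
    rw [hW]
  ext a b'
  rw [Matrix.sum_apply, Matrix.neg_apply, Matrix.sub_apply, Matrix.diagonal_mul, Matrix.mul_diagonal]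
  simp only [Matrix.smul_apply, Matrix.submatrix_apply, perF_apply, smul_eq_mul]
  rw [Fintype.sum_prod_type]
  rw [sum_tgrad_mul_perZ_dper_borderT2per (M := M) (M' := M') β.2 (β.1 : Site 4) hM hV s _ _ (mμ a) b'.2]
  ring

/-- [folklore] **ANY BOX, ANY MULTIPLIER PRESENTATION, ANY TORUS GAUGE FUNCTION** `λ : ↥(pbox M) → ℝ` (`(Dλ)_b := Σ_s tgrad M b s · λ s`):
`Σ_b (Dλ)_b • Q₂^{b,β} = −(R_λ * Q₁^{β} − Q₁^{β} * E_λ)`, `E_λ := diagonal (λ b.1)`, `R_λ := diagonal (Σ_s tdelta M (pμ a + ρ_c) s · λ s)`. -/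
theorem torus_symQ12_pureGauge_fst_fun_of_presentation (hM : ∀ i, M i = Lc * M' i) {W : Fin 4 → Site 4 → Fin 4 → Site 4 → MKer 4 (Fib 3)}
    (hW : W = fun κ' u' κ u x z a c => ∑' n : Site 4, symVh₂SAn1 3 Lc κ u κ' (translate M u' n) x z a c)
    {κI : Type*} [Fintype κI] [DecidableEq κI] (pμ : κI → Site 4) (hpμ : ∀ a, pμ a ∈ pbox M) (mμ : κI → Fin 4)
    (β : ↥(pbox M) × Fin 4) (lam : ↥(pbox M) → ℝ) :
    (∑ b : ↥(pbox M) × Fin 4, (∑ s : ↥(pbox M), tgrad M (b.1, Sum.inl b.2) s * lam s) •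
        (perF M (dper M (W β.2 (β.1 : Site 4) b.2 (b.1 : Site 4)))).submatrix
          (fun a : κI => ((⟨pμ a, hpμ a⟩, Sum.inr (mμ a)) : Idx M (Fib 3)))
          (fun b : ↥(pbox M) × Fin 4 => ((b.1, Sum.inl b.2) : Idx M (Fib 3))))
      = -(Matrix.diagonal (fun a : κI => ∑ s : ↥(pbox M), tdelta M (pμ a + ctr 4 Lc) s * lam s)
            * (perF M (dper M (symVhSAt (ctr 4 Lc) 3 Lc rfl β.2 (β.1 : Site 4)))).submatrix
              (fun a : κI => ((⟨pμ a, hpμ a⟩, Sum.inr (mμ a)) : Idx M (Fib 3)))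
              (fun b : ↥(pbox M) × Fin 4 => ((b.1, Sum.inl b.2) : Idx M (Fib 3)))
          - (perF M (dper M (symVhSAt (ctr 4 Lc) 3 Lc rfl β.2 (β.1 : Site 4)))).submatrix
              (fun a : κI => ((⟨pμ a, hpμ a⟩, Sum.inr (mμ a)) : Idx M (Fib 3)))
              (fun b : ↥(pbox M) × Fin 4 => ((b.1, Sum.inl b.2) : Idx M (Fib 3)))
            * Matrix.diagonal (fun b : ↥(pbox M) × Fin 4 => lam b.1)) := by
  have hswap : (∑ b : ↥(pbox M) × Fin 4, (∑ s : ↥(pbox M), tgrad M (b.1, Sum.inl b.2) s * lam s) •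
        (perF M (dper M (W β.2 (β.1 : Site 4) b.2 (b.1 : Site 4)))).submatrix
          (fun a : κI => ((⟨pμ a, hpμ a⟩, Sum.inr (mμ a)) : Idx M (Fib 3)))
          (fun b : ↥(pbox M) × Fin 4 => ((b.1, Sum.inl b.2) : Idx M (Fib 3))))
      = ∑ s : ↥(pbox M), lam s • ∑ b : ↥(pbox M) × Fin 4, tgrad M (b.1, Sum.inl b.2) s •
        (perF M (dper M (W β.2 (β.1 : Site 4) b.2 (b.1 : Site 4)))).submatrix
          (fun a : κI => ((⟨pμ a, hpμ a⟩, Sum.inr (mμ a)) : Idx M (Fib 3)))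
          (fun b : ↥(pbox M) × Fin 4 => ((b.1, Sum.inl b.2) : Idx M (Fib 3))) := by
    simp only [Finset.sum_smul, Finset.smul_sum, smul_smul, mul_comm (lam _)]
    exact Finset.sum_comm
  rw [hswap, Finset.sum_congr rfl fun s _ => by rw [torus_symQ12_pureGauge_fst_of_presentation hM hW pμ hpμ mμ β s]]
  ext a b'
  simp only [Matrix.sum_apply, Matrix.smul_apply, Matrix.neg_apply, Matrix.sub_apply, Matrix.diagonal_mul, Matrix.mul_diagonal, smul_eq_mul]
  rw [show lam b'.1 = ∑ s : ↥(pbox M), tdelta M ((b'.1 : ↥(pbox M)) : Site 4) s * lam s by rw [sum_tdelta_mul, wrapPt_of_mem]]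
  simp only [Finset.mul_sum, Finset.sum_mul, mul_sub, Finset.sum_sub_distrib, mul_neg, Finset.sum_neg_distrib]
  congr 1
  congr 1 <;> exact Finset.sum_congr rfl fun s _ => by ring

variable (M'' : Fin 4 → ℕ) [∀ μ, NeZero (M'' μ)]

/-- [folklore] **`torus_symQ12_pureGauge_fst_fun` — AT THE (III′) TORUS CALL's TYPES** (fine box `F = fine Lc M″`; rows `a ↦ (coarsePt M″ Lc a.1, inr a.2)`,
columns `b ↦ (b.1, inl b.2)` — the door's `Q₁₁ ∕ Q₁₂` slot presentation): for the second torus bond `β` and every torus gauge function `λ : ↥(pbox F) → ℝ`,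
`Σ_b (Dλ)_b • Q₁₂^{b,β} = −(R_λ * Q₁₁^{β} − Q₁₁^{β} * E_λ)`, `E_λ := diagonal (λ b.1)`, `R_λ := diagonal (Σ_s tdelta F (Lc•a.1 + ρ_c) s · λ s)` — the SAME
rotations as (α-1)'s `torus_symQ11_pureGauge_fun`, NO `c_j` (the contact kernel is the first-order TABLE itself, not the spread). -/
theorem torus_symQ12_pureGauge_fst_fun {W : Fin 4 → Site 4 → Fin 4 → Site 4 → MKer 4 (Fib 3)}
    (hW : W = fun κ' u' κ u x z a c => ∑' n : Site 4, symVh₂SAn1 3 Lc κ u κ' (translate (fine Lc M'') u' n) x z a c)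
    (β : ↥(pbox (fine Lc M'')) × Fin 4) (lam : ↥(pbox (fine Lc M'')) → ℝ) :
    (∑ b : ↥(pbox (fine Lc M'')) × Fin 4, (∑ s : ↥(pbox (fine Lc M'')), tgrad (fine Lc M'') (b.1, Sum.inl b.2) s * lam s) •
        (perF (fine Lc M'') (dper (fine Lc M'') (W β.2 (β.1 : Site 4) b.2 (b.1 : Site 4)))).submatrix
          (fun a : ↥(pbox M'') × Fin 4 => ((coarsePt M'' Lc a.1, Sum.inr a.2) : Idx (fine Lc M'') (Fib 3)))
          (fun b : ↥(pbox (fine Lc M'')) × Fin 4 => ((b.1, Sum.inl b.2) : Idx (fine Lc M'') (Fib 3))))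
      = -(Matrix.diagonal (fun a : ↥(pbox M'') × Fin 4 =>
              ∑ s : ↥(pbox (fine Lc M'')), tdelta (fine Lc M'') ((Lc : ℤ) • (a.1 : Site 4) + ctr 4 Lc) s * lam s)
            * (perF (fine Lc M'') (dper (fine Lc M'') (symVhSAt (ctr 4 Lc) 3 Lc rfl β.2 (β.1 : Site 4)))).submatrix
              (fun a : ↥(pbox M'') × Fin 4 => ((coarsePt M'' Lc a.1, Sum.inr a.2) : Idx (fine Lc M'') (Fib 3)))
              (fun b : ↥(pbox (fine Lc M'')) × Fin 4 => ((b.1, Sum.inl b.2) : Idx (fine Lc M'') (Fib 3)))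
          - (perF (fine Lc M'') (dper (fine Lc M'') (symVhSAt (ctr 4 Lc) 3 Lc rfl β.2 (β.1 : Site 4)))).submatrix
              (fun a : ↥(pbox M'') × Fin 4 => ((coarsePt M'' Lc a.1, Sum.inr a.2) : Idx (fine Lc M'') (Fib 3)))
              (fun b : ↥(pbox (fine Lc M'')) × Fin 4 => ((b.1, Sum.inl b.2) : Idx (fine Lc M'') (Fib 3)))
            * Matrix.diagonal (fun b : ↥(pbox (fine Lc M'')) × Fin 4 => lam b.1)) :=
  torus_symQ12_pureGauge_fst_fun_of_presentation (M := fine Lc M'') (M' := M'') (fun _ => rfl) hW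
    (fun a : ↥(pbox M'') × Fin 4 => (coarsePt M'' Lc a.1 : Site 4)) (fun a => (coarsePt M'' Lc a.1).2) (fun a => a.2) β lam

end Torus

end Summit.QuantumFields.BalabanUV.Beta.FP.PeriodisedSymBorderT2IndexWard

end
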